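import Literature.Geometry.Lorentzian.KerrFlatRangeWeight
import Literature.Geometry.Lorentzian.KerrSharpSupProfiles
import HarnessLib

/-!
# The logarithmic cut-off `h` and the weight `y = ε/(r*V) + c` of the low-frequency ranges of
# Dafermos–Rodnianski–Shlapentokh-Rothman (Props. 8.7.1–8.7.2): a one-sided `C¹/C²` construction

(family `gr`, infrastructure for statement **gr.S24**; namespace `Literature.Geometry.Lorentzian.Kerr`)

Dafermos–Rodnianski–Shlapentokh-Rothman (*Decay for solutions of the wave equation on Kerr exterior
spacetimes III*, arXiv:1402.7034 = Ann. of Math. 183 (2016)) treat the near-stationary frequencies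
`|ω| ≤ ω_low` of the bounded range `𝓖_♭` (§8.7.1, Prop. 8.7.1: `m ≠ 0`, `a < ã₀`; §8.7.2,
Prop. 8.7.2: `m = 0`) with a current `Ϙ^h + ϟ^y + ϟ^ŷ (− E χ₂ Q^T − χ₁ Q^K)` whose weights are, towards
`r* = +∞` ((ccchoices)–(cchoices2) of loc. cit.),

* a cut-off `h` with `h = 1` for `r* ≤ R₂*`, `h = 0` for `r* ≥ e^{1/p} R₂*` and
  **`|h''| ≤ Bp/(r*)²`** in between (a cut-off in the variable `log r*`),
* the weight `y = 0` for `r* ≤ R₂* − 1`, `y = (r* − R₂* + 1)/2` on `[R₂* − 1, R₂*]`,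
  **`y = ε(1/(r*V) − 1/(R₂*V(R₂*))) + ½`** on `[R₂*, e^{1/p}R₂*]` and `y` constant beyond,

so that the `|u|²`-coefficient `h(V − ω²) − (yV)' + y'ω² − ½h''` of the bulk is bounded below by
`(ε − Bp/2)(r*)⁻² ≥ 0` on the logarithmic zone ("we may choose `p` small enough depending on `ε`"),
while `y' ≥ 0` because `(r*V)' ≤ 0` there; towards the horizon the mirror-image weight `ŷ` is used
with `Ṽ = V − V(r₊)` in place of `V` (loc. cit., proof of Prop. 8.7.1, (haty1)–(haty3)).

This file carries out this construction **once, in an abstract variable `t ≥ T − 1 > 0` for an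
abstract positive decreasing potential `W` with `(1 + c)W ≤ t|W'|`**, with explicit `C²` (cut-off)
and `C¹` (weight) profiles — the printed `y` is only Lipschitz at `R₂* − 1`, `R₂*`, `e^{1/p}R₂*`,
which the current `ϟ^y` does not literally allow — and proves the pointwise coefficient inequality.
The same lemma serves both ends of `ℝ`: at `r* → +∞` with `t = r* − x₀`, `W = V ∘ R`, frequency
`ω²`; at the horizon with `t = x₁ − r*`, `W = Ṽ ∘ R`, frequency `(ω − ω₊m)² = ω² − V(r₊)` (the
bulk coefficient is invariant under this reflection). The Kerr-specific inputs (the three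
"easily verified" properties of `V` in loc. cit.) and the estimates themselves are in the sequel
files.

* `Kerr.lowFreqCutoff p Tₕ t = sharpBump(1 + p·log(max(t,Tₕ)/Tₕ))` (`sharpBump = cutoff 2` of
  `KerrSharpSupProfiles`): `= 1` on `t ≤ Tₕ`, `= 0` on `t ≥ Tₕe^{1/p}`, values in `[0,1]`, with
  derivative functions `lowFreqCutoff₁`, `lowFreqCutoff₂` and **`|h''| ≤ p(D₁ + D₂)/t²`**
  (`Kerr.abs_lowFreqCutoff₂_le`).
* `Kerr.softClamp`, `Kerr.satRamp u₀ U₁` — a `C¹` reparametrisation `G` with `G(u) = u²/(2u₀)`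
  (soft start), `= u − u₀/2` on `[u₀, U₁]`, saturating at `U₁ − u₀/2 + ½` for `u ≥ U₁ + 1`,
  `0 ≤ G' ≤ 1`, and the key inequality **`G(u) − G'(u)(u + K) ≥ −(u₀/2 + K)`**
  (`Kerr.satRamp_sub_mul_ge`).
* `Kerr.lowFreqF W T t = 1/(tW(t)) − 1/(TW(T))` and the weight
  `Kerr.lowFreqWeight W T ε u₀ U₁ t = ½ softStep(t − T + 1) + ε G(F(max(t,T)))` with derivative
  function `lowFreqWeightDeriv`; `= 0` for `t ≤ T − 1`, non-decreasing, eventually equal to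
  `lowFreqTop ε u₀ U₁ = ½ + ε(U₁ − u₀/2 + ½)`.
* `Kerr.lowFreq_gain_ge` — the identity-turned-inequality
  `−(Y'W + YW') ≥ ¼|W'| + εG'(F)/t²` for `t ≥ T`, and
  **`Kerr.lowFreq_coeff_nonneg`** — for `t ≥ T − 1` and `ϖ² ≤ W(2Te^{1/p})`:
  `h(W − ϖ²) − ½h'' + Y'(ϖ² − W) − YW' ≥ 0`, provided `5ε ≤ TW(T)`, `u₀ = c/(4TW(T))`,
  `F(2Te^{1/p}) ≤ U₁`, `p ≤ 1`, `p(D₁ + D₂) ≤ 2ε`.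

No named facts (D-0026); everything is proved.

## References

* M. Dafermos, I. Rodnianski, Y. Shlapentokh-Rothman, arXiv:1402.7034 = Ann. of Math. 183 (2016),
  §8.7.1 (proof of Prop. 8.7.1: (ccchoices), (ccchoices2), (y1)–(y3), (haty1)–(haty3), (axisym1)–
  (axisym3), (someInequality)), §8.7.2 (Prop. 8.7.2) (key `DafermosRodnianskiShlapentokhrothman2014`).
-/

noncomputable section

open Set Filter Topology

namespace Literature.Geometry.Lorentzian

namespace Kerr

/-! ### Boundary values of `sharpBump₁`, `sharpBump₂` -/

/-- `φ' = 0` on the closed plateau `|t| ≤ 1` (closure of `sharpBump₁_eq_zero_of_lt`). [folklore] -/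
theorem sharpBump₁_eq_zero_of_abs_le_one {t : ℝ} (h : |t| ≤ 1) : sharpBump₁ t = 0 := by
  have hsub : Metric.ball (0 : ℝ) 1 ⊆ {s | sharpBump₁ s = 0} := fun s hs ↦ by
    rw [Metric.mem_ball, Real.dist_eq, sub_zero] at hs
    exact sharpBump₁_eq_zero_of_lt hs
  have hcl : IsClosed {s : ℝ | sharpBump₁ s = 0} := isClosed_eq continuous_sharpBump₁ continuous_const
  have h' := hcl.closure_subset_iff.2 hsub
  rw [closure_ball (0 : ℝ) one_ne_zero] at h'
  exact h' (by rw [Metric.mem_closedBall, Real.dist_eq, sub_zero]; exact h)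

/-- `φ'' = 0` on the closed plateau `|t| ≤ 1`. [folklore] -/
theorem sharpBump₂_eq_zero_of_abs_le_one {t : ℝ} (h : |t| ≤ 1) : sharpBump₂ t = 0 := by
  have hsub : Metric.ball (0 : ℝ) 1 ⊆ {s | sharpBump₂ s = 0} := fun s hs ↦ by
    rw [Metric.mem_ball, Real.dist_eq, sub_zero] at hs
    exact sharpBump₂_eq_zero_of_abs_lt_one hs
  have hcl : IsClosed {s : ℝ | sharpBump₂ s = 0} := isClosed_eq continuous_sharpBump₂ continuous_const
  have h' := hcl.closure_subset_iff.2 hsub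
  rw [closure_ball (0 : ℝ) one_ne_zero] at h'
  exact h' (by rw [Metric.mem_closedBall, Real.dist_eq, sub_zero]; exact h)

/-- `φ'' = 0` for `|t| ≥ 2` (closure of `sharpBump₂_eq_zero_of_lt`). [folklore] -/
theorem sharpBump₂_eq_zero_of_two_le {t : ℝ} (h : 2 ≤ |t|) : sharpBump₂ t = 0 := by
  have hcl : IsClosed {s : ℝ | sharpBump₂ s = 0} := isClosed_eq continuous_sharpBump₂ continuous_const
  have hsub : Ioi (2 : ℝ) ∪ Iio (-2) ⊆ {s | sharpBump₂ s = 0} := by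
    rintro s (hs | hs)
    · exact sharpBump₂_eq_zero_of_lt (lt_of_lt_of_le hs (le_abs_self s))
    · exact sharpBump₂_eq_zero_of_lt (by rw [mem_Iio] at hs; have := neg_le_abs s; linarith)
  have h' := hcl.closure_subset_iff.2 hsub
  rw [closure_union, closure_Ioi, closure_Iio] at h'
  rcases le_abs'.1 h with ht | ht
  · exact h' (Or.inr ht)
  · exact h' (Or.inl ht)

/-! ### The logarithmic cut-off -/

/-- **The logarithmic cut-off** `h(t) = φ(1 + p log(max(t,Tₕ)/Tₕ))`, `φ = sharpBump`: an explicit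
function with the properties (ccchoices)–(ccchoices2) of DRSR arXiv:1402.7034, §8.7.1 (`h = 1` for
`t ≤ Tₕ`, `h = 0` for `t ≥ e^{1/p}Tₕ`, `|h''| ≤ Bp/t²`). [cite: DafermosRodnianskiShlapentokhrothman2014, §8.7.1] -/
def lowFreqCutoff (p Th t : ℝ) : ℝ :=
  sharpBump (1 + p * Real.log (max t Th / Th))

/-- The derivative `h'(t) = φ'(·) p / max(t,Tₕ)` of `lowFreqCutoff`. [cite: DafermosRodnianskiShlapentokhrothman2014, §8.7.1] -/
def lowFreqCutoff₁ (p Th t : ℝ) : ℝ :=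
  sharpBump₁ (1 + p * Real.log (max t Th / Th)) * (p / max t Th)

/-- The second derivative `h''(t) = (φ''(·) p² − φ'(·) p)/max(t,Tₕ)²` of `lowFreqCutoff`.
[cite: DafermosRodnianskiShlapentokhrothman2014, §8.7.1] -/
def lowFreqCutoff₂ (p Th t : ℝ) : ℝ :=
  (sharpBump₂ (1 + p * Real.log (max t Th / Th)) * p ^ 2 -
    sharpBump₁ (1 + p * Real.log (max t Th / Th)) * p) / max t Th ^ 2

section Cutoff

variable {p Th : ℝ}

/-- `h = 1` for `t ≤ Tₕ`. [cite: DafermosRodnianskiShlapentokhrothman2014, §8.7.1] -/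
theorem lowFreqCutoff_eq_one (hTh : 0 < Th) {t : ℝ} (ht : t ≤ Th) : lowFreqCutoff p Th t = 1 := by
  unfold lowFreqCutoff
  rw [max_eq_right ht, div_self hTh.ne', Real.log_one, mul_zero, add_zero]
  exact sharpBump_eq_one (by norm_num)

/-- `h' = 0` for `t ≤ Tₕ`. [folklore] -/
theorem lowFreqCutoff₁_eq_zero_of_le (hTh : 0 < Th) {t : ℝ} (ht : t ≤ Th) :
    lowFreqCutoff₁ p Th t = 0 := by
  unfold lowFreqCutoff₁
  rw [max_eq_right ht, div_self hTh.ne', Real.log_one, mul_zero, add_zero,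
    sharpBump₁_eq_zero_of_abs_le_one (by norm_num), zero_mul]

/-- `h'' = 0` for `t ≤ Tₕ`. [folklore] -/
theorem lowFreqCutoff₂_eq_zero_of_le (hTh : 0 < Th) {t : ℝ} (ht : t ≤ Th) :
    lowFreqCutoff₂ p Th t = 0 := by
  unfold lowFreqCutoff₂
  rw [max_eq_right ht, div_self hTh.ne', Real.log_one, mul_zero, add_zero,
    sharpBump₁_eq_zero_of_abs_le_one (by norm_num), sharpBump₂_eq_zero_of_abs_le_one (by norm_num)]
  simp

/-- For `t ≥ Tₕ e^{1/p}` the argument of `φ` is at least `2`. [folklore] -/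
theorem two_le_lowFreqArg (hTh : 0 < Th) (hp : 0 < p) {t : ℝ} (ht : Th * Real.exp (1 / p) ≤ t) :
    2 ≤ 1 + p * Real.log (max t Th / Th) := by
  have hexp : 1 < Real.exp (1 / p) := Real.one_lt_exp_iff.2 (one_div_pos.2 hp)
  have h1 : Th ≤ t := le_trans (le_mul_of_one_le_right hTh.le hexp.le) ht
  rw [max_eq_left h1]
  have h2 : Real.exp (1 / p) ≤ t / Th := by rwa [le_div_iff₀ hTh, mul_comm]
  have h3 : 1 / p ≤ Real.log (t / Th) := by
    rw [← Real.log_exp (1 / p)]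
    exact Real.log_le_log (Real.exp_pos _) h2
  have h4 : 1 ≤ p * Real.log (t / Th) := by
    calc (1 : ℝ) = p * (1 / p) := by field_simp
      _ ≤ p * Real.log (t / Th) := mul_le_mul_of_nonneg_left h3 hp.le
  linarith

/-- `h = 0` for `t ≥ Tₕ e^{1/p}`. [cite: DafermosRodnianskiShlapentokhrothman2014, §8.7.1] -/
theorem lowFreqCutoff_eq_zero (hTh : 0 < Th) (hp : 0 < p) {t : ℝ} (ht : Th * Real.exp (1 / p) ≤ t) :
    lowFreqCutoff p Th t = 0 := by
  have h := two_le_lowFreqArg hTh hp ht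
  exact sharpBump_eq_zero (le_trans h (le_abs_self _))

/-- `h' = 0` for `t ≥ Tₕ e^{1/p}`. [folklore] -/
theorem lowFreqCutoff₁_eq_zero_of_ge (hTh : 0 < Th) (hp : 0 < p) {t : ℝ}
    (ht : Th * Real.exp (1 / p) ≤ t) : lowFreqCutoff₁ p Th t = 0 := by
  have h := two_le_lowFreqArg hTh hp ht
  unfold lowFreqCutoff₁
  rw [sharpBump₁_eq_zero_of_le (le_trans h (le_abs_self _)), zero_mul]

/-- `h'' = 0` for `t ≥ Tₕ e^{1/p}`. [folklore] -/
theorem lowFreqCutoff₂_eq_zero_of_ge (hTh : 0 < Th) (hp : 0 < p) {t : ℝ}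
    (ht : Th * Real.exp (1 / p) ≤ t) : lowFreqCutoff₂ p Th t = 0 := by
  have h := two_le_lowFreqArg hTh hp ht
  unfold lowFreqCutoff₂
  rw [sharpBump₁_eq_zero_of_le (le_trans h (le_abs_self _)),
    sharpBump₂_eq_zero_of_two_le (le_trans h (le_abs_self _))]
  simp

/-- `0 ≤ h ≤ 1`. [folklore] -/
theorem lowFreqCutoff_mem_Icc (p Th t : ℝ) : lowFreqCutoff p Th t ∈ Icc (0 : ℝ) 1 :=
  ⟨sharpBump_nonneg _, sharpBump_le_one _⟩

/-- **`|h''| ≤ p(D₁ + D₂)/t²`** for `t ≥ Tₕ`, `0 < p ≤ 1` (the bound "`|h''| ≤ Bp/|r*|²`" of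
(ccchoices2)). [cite: DafermosRodnianskiShlapentokhrothman2014, §8.7.1] -/
theorem abs_lowFreqCutoff₂_le {D₁ D₂ : ℝ} (hD₁ : ∀ s, |sharpBump₁ s| ≤ D₁)
    (hD₂ : ∀ s, |sharpBump₂ s| ≤ D₂) (hp : 0 < p) (hp1 : p ≤ 1) {t : ℝ} (hTh : 0 < Th)
    (ht : Th ≤ t) : |lowFreqCutoff₂ p Th t| ≤ p * (D₁ + D₂) / t ^ 2 := by
  have ht0 : 0 < t := hTh.trans_le ht
  unfold lowFreqCutoff₂
  rw [max_eq_left ht, abs_div, abs_of_pos (pow_pos ht0 2), div_le_div_iff_of_pos_right (pow_pos ht0 2)]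
  set s := 1 + p * Real.log (t / Th)
  have h1 := hD₁ s
  have h2 := hD₂ s
  have hD₁0 : 0 ≤ D₁ := (abs_nonneg _).trans h1
  have hD₂0 : 0 ≤ D₂ := (abs_nonneg _).trans h2
  calc |sharpBump₂ s * p ^ 2 - sharpBump₁ s * p|
      ≤ |sharpBump₂ s * p ^ 2| + |sharpBump₁ s * p| := abs_sub _ _
    _ = |sharpBump₂ s| * p ^ 2 + |sharpBump₁ s| * p := by
        rw [abs_mul, abs_mul, abs_of_pos hp, abs_of_pos (pow_pos hp 2)]
    _ ≤ D₂ * p ^ 2 + D₁ * p := by gcongr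
    _ ≤ D₂ * p + D₁ * p := by
        have hp2 : p ^ 2 ≤ p := by nlinarith
        nlinarith [mul_le_mul_of_nonneg_left hp2 hD₂0]
    _ = p * (D₁ + D₂) := by ring

/-- On the open half-line `t > Tₕ e^{−1/p}` the cut-off agrees with the smooth formula
`φ(1 + p log(t/Tₕ))`. [folklore] -/
theorem lowFreqCutoff_eq_of_gt (hTh : 0 < Th) (hp : 0 < p) {t : ℝ}
    (ht : Th * Real.exp (-(1 / p)) < t) :
    lowFreqCutoff p Th t = sharpBump (1 + p * Real.log (t / Th)) := by
  rcases le_or_gt Th t with h | h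
  · unfold lowFreqCutoff; rw [max_eq_left h]
  · rw [lowFreqCutoff_eq_one hTh h.le]
    have ht0 : 0 < t := lt_trans (by positivity) ht
    have hlt : Real.exp (-(1 / p)) < t / Th := by rwa [lt_div_iff₀ hTh, mul_comm]
    have h1 : -(1 / p) < Real.log (t / Th) := by
      rw [← Real.log_exp (-(1 / p))]
      exact Real.log_lt_log (Real.exp_pos _) hlt
    have h2 : Real.log (t / Th) < 0 := Real.log_neg (by positivity) (by rwa [div_lt_one hTh])
    have h3 : -1 < p * Real.log (t / Th) := by
      have : p * (-(1 / p)) = -1 := by field_simp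
      nlinarith
    have h4 : p * Real.log (t / Th) < 0 := mul_neg_of_pos_of_neg hp h2
    exact (sharpBump_eq_one (by rw [abs_le]; constructor <;> linarith)).symm

/-- The argument `1 + p log(t/Tₕ)` has derivative `p/t` (`t > 0`). [folklore] -/
theorem hasDerivAt_lowFreqArg (hTh : 0 < Th) {t : ℝ} (ht : 0 < t) :
    HasDerivAt (fun t : ℝ ↦ 1 + p * Real.log (t / Th)) (p / t) t := by
  have h1 : HasDerivAt (fun t : ℝ ↦ t / Th) (1 / Th) t := (hasDerivAt_id t).div_const Th
  have h2 : HasDerivAt (fun t : ℝ ↦ Real.log (t / Th)) ((1 / Th) / (t / Th)) t :=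
    h1.log (by positivity)
  have h3 := (h2.const_mul p).const_add 1
  refine h3.congr_deriv ?_
  field_simp

/-- **`h` is differentiable with derivative `h'`** (everywhere on `ℝ`). [folklore] -/
theorem hasDerivAt_lowFreqCutoff (hTh : 0 < Th) (hp : 0 < p) (t : ℝ) :
    HasDerivAt (lowFreqCutoff p Th) (lowFreqCutoff₁ p Th t) t := by
  rcases lt_or_ge t Th with h | h
  · -- locally constant
    have hev : lowFreqCutoff p Th =ᶠ[𝓝 t] fun _ ↦ (1 : ℝ) := by
      filter_upwards [Iio_mem_nhds h] with s hs using lowFreqCutoff_eq_one hTh (le_of_lt hs)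
    rw [lowFreqCutoff₁_eq_zero_of_le hTh h.le]
    exact (hasDerivAt_const t (1 : ℝ)).congr_of_eventuallyEq hev
  · have ht0 : 0 < t := hTh.trans_le h
    have hlt : Th * Real.exp (-(1 / p)) < t :=
      lt_of_lt_of_le (mul_lt_of_lt_one_right hTh (Real.exp_lt_one_iff.2 (by
        have := one_div_pos.2 hp; linarith))) h
    have hev : lowFreqCutoff p Th =ᶠ[𝓝 t] fun s ↦ sharpBump (1 + p * Real.log (s / Th)) := by
      filter_upwards [Ioi_mem_nhds hlt] with s hs using lowFreqCutoff_eq_of_gt hTh hp hs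
    have hd := (hasDerivAt_sharpBump _).comp t (hasDerivAt_lowFreqArg (p := p) hTh ht0)
    have hd' : HasDerivAt (fun s ↦ sharpBump (1 + p * Real.log (s / Th)))
        (sharpBump₁ (1 + p * Real.log (t / Th)) * (p / t)) t := hd
    unfold lowFreqCutoff₁
    rw [max_eq_left h]
    exact hd'.congr_of_eventuallyEq hev

/-- On `t > Tₕ e^{−1/p}` the derivative agrees with the smooth formula. [folklore] -/
theorem lowFreqCutoff₁_eq_of_gt (hTh : 0 < Th) (hp : 0 < p) {t : ℝ}
    (ht : Th * Real.exp (-(1 / p)) < t) :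
    lowFreqCutoff₁ p Th t = sharpBump₁ (1 + p * Real.log (t / Th)) * (p / t) := by
  rcases le_or_gt Th t with h | h
  · unfold lowFreqCutoff₁; rw [max_eq_left h]
  · rw [lowFreqCutoff₁_eq_zero_of_le hTh h.le]
    have ht0 : 0 < t := lt_trans (by positivity) ht
    have hlt : Real.exp (-(1 / p)) < t / Th := by rwa [lt_div_iff₀ hTh, mul_comm]
    have h1 : -(1 / p) < Real.log (t / Th) := by
      rw [← Real.log_exp (-(1 / p))]
      exact Real.log_lt_log (Real.exp_pos _) hlt
    have h2 : Real.log (t / Th) < 0 := Real.log_neg (by positivity) (by rwa [div_lt_one hTh])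
    have h3 : -1 < p * Real.log (t / Th) := by
      have : p * (-(1 / p)) = -1 := by field_simp
      nlinarith
    have h4 : p * Real.log (t / Th) < 0 := mul_neg_of_pos_of_neg hp h2
    rw [sharpBump₁_eq_zero_of_lt (by rw [abs_lt]; constructor <;> linarith), zero_mul]

/-- **`h'` is differentiable with derivative `h''`** (everywhere on `ℝ`). [folklore] -/
theorem hasDerivAt_lowFreqCutoff₁ (hTh : 0 < Th) (hp : 0 < p) (t : ℝ) :
    HasDerivAt (lowFreqCutoff₁ p Th) (lowFreqCutoff₂ p Th t) t := by
  rcases lt_or_ge t Th with h | h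
  · have hev : lowFreqCutoff₁ p Th =ᶠ[𝓝 t] fun _ ↦ (0 : ℝ) := by
      filter_upwards [Iio_mem_nhds h] with s hs using lowFreqCutoff₁_eq_zero_of_le hTh (le_of_lt hs)
    rw [lowFreqCutoff₂_eq_zero_of_le hTh h.le]
    exact (hasDerivAt_const t (0 : ℝ)).congr_of_eventuallyEq hev
  · have ht0 : 0 < t := hTh.trans_le h
    have hlt : Th * Real.exp (-(1 / p)) < t :=
      lt_of_lt_of_le (mul_lt_of_lt_one_right hTh (Real.exp_lt_one_iff.2 (by
        have := one_div_pos.2 hp; linarith))) h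
    have hev : lowFreqCutoff₁ p Th =ᶠ[𝓝 t]
        fun s ↦ sharpBump₁ (1 + p * Real.log (s / Th)) * (p / s) := by
      filter_upwards [Ioi_mem_nhds hlt] with s hs using lowFreqCutoff₁_eq_of_gt hTh hp hs
    have hd1 := (hasDerivAt_sharpBump₁ _).comp t (hasDerivAt_lowFreqArg (p := p) hTh ht0)
    have hd1' : HasDerivAt (fun s ↦ sharpBump₁ (1 + p * Real.log (s / Th)))
        (sharpBump₂ (1 + p * Real.log (t / Th)) * (p / t)) t := hd1
    have hd2 : HasDerivAt (fun s : ℝ ↦ p / s) (-p / t ^ 2) t := by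
      have h' := (hasDerivAt_inv ht0.ne').const_mul p
      have heq : (fun s : ℝ ↦ p / s) = fun s ↦ p * s⁻¹ := funext fun s ↦ div_eq_mul_inv p s
      rw [heq]
      refine h'.congr_deriv ?_
      field_simp
    have hd := hd1'.mul hd2
    unfold lowFreqCutoff₂
    rw [max_eq_left h]
    refine (hd.congr_of_eventuallyEq hev).congr_deriv ?_
    field_simp
    ring

/-- `h`, `h'`, `h''` are continuous. [folklore] -/
theorem continuous_lowFreqCutoff (hTh : 0 < Th) (hp : 0 < p) : Continuous (lowFreqCutoff p Th) :=
  continuous_iff_continuousAt.2 fun t ↦ (hasDerivAt_lowFreqCutoff hTh hp t).continuousAt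

end Cutoff

/-! ### The soft clamp and the saturating ramp `G` -/

/-- The `C¹` primitive `r(v) = (max(v,0)² − max(v − 1,0)²)/2` of the clamp `min(max(v,0),1)`:
`r = 0` on `v ≤ 0`, `r = v²/2` on `[0,1]`, `r = v − ½` on `v ≥ 1`. [folklore] -/
def softClamp (v : ℝ) : ℝ :=
  (max v 0 ^ 2 - max (v - 1) 0 ^ 2) / 2

/-- The derivative `r'(v) = max(v,0) − max(v − 1,0) = min(max(v,0),1)` of `softClamp`. [folklore] -/
def softClampDeriv (v : ℝ) : ℝ :=
  max v 0 - max (v - 1) 0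

/-- `r' ` is the derivative of `r`. [folklore] -/
theorem hasDerivAt_softClamp (v : ℝ) : HasDerivAt softClamp (softClampDeriv v) v := by
  have h0 := hasDerivAt_max_zero_sq v
  have h1 : HasDerivAt (fun s : ℝ ↦ max (s - 1) 0 ^ 2) (2 * max (v - 1) 0) v := by
    have h := (hasDerivAt_max_zero_sq (v - 1)).comp v ((hasDerivAt_id v).sub_const 1)
    simpa [Function.comp_def] using h
  have h := (h0.sub h1).div_const 2
  refine h.congr_deriv ?_
  unfold softClampDeriv
  ring

/-- `r = 0`, `r' = 0` on `v ≤ 0`. [folklore] -/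
theorem softClamp_of_nonpos {v : ℝ} (hv : v ≤ 0) : softClamp v = 0 ∧ softClampDeriv v = 0 := by
  have h1 : max v 0 = 0 := max_eq_right hv
  have h2 : max (v - 1) 0 = 0 := max_eq_right (by linarith)
  simp [softClamp, softClampDeriv, h1, h2]

/-- `r = v²/2`, `r' = v` on `[0, 1]`. [folklore] -/
theorem softClamp_of_mem {v : ℝ} (h0 : 0 ≤ v) (h1 : v ≤ 1) :
    softClamp v = v ^ 2 / 2 ∧ softClampDeriv v = v := by
  have h1' : max v 0 = v := max_eq_left h0
  have h2 : max (v - 1) 0 = 0 := max_eq_right (by linarith)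
  simp [softClamp, softClampDeriv, h1', h2]

/-- `r = v − ½`, `r' = 1` on `v ≥ 1`. [folklore] -/
theorem softClamp_of_one_le {v : ℝ} (h1 : 1 ≤ v) :
    softClamp v = v - 1 / 2 ∧ softClampDeriv v = 1 := by
  have h1' : max v 0 = v := max_eq_left (by linarith)
  have h2 : max (v - 1) 0 = v - 1 := max_eq_left (by linarith)
  simp only [softClamp, softClampDeriv, h1', h2]
  constructor <;> ring

/-- `0 ≤ r' ≤ 1`. [folklore] -/
theorem softClampDeriv_mem_Icc (v : ℝ) : softClampDeriv v ∈ Icc (0 : ℝ) 1 := by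
  rcases le_or_gt v 0 with h | h
  · rw [(softClamp_of_nonpos h).2]; exact ⟨le_rfl, zero_le_one⟩
  rcases le_or_gt v 1 with h' | h'
  · rw [(softClamp_of_mem h.le h').2]; exact ⟨h.le, h'⟩
  · rw [(softClamp_of_one_le h'.le).2]; exact ⟨zero_le_one, le_rfl⟩

/-- `r'` is monotone. [folklore] -/
theorem softClampDeriv_mono : Monotone softClampDeriv := by
  intro v w hvw
  rcases le_or_gt w 0 with hw | hw
  · rw [(softClamp_of_nonpos hw).2, (softClamp_of_nonpos (hvw.trans hw)).2]
  rcases le_or_gt w 1 with hw' | hw'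
  · rw [(softClamp_of_mem hw.le hw').2]
    rcases le_or_gt v 0 with hv | hv
    · rw [(softClamp_of_nonpos hv).2]; exact hw.le
    · rw [(softClamp_of_mem hv.le (hvw.trans hw')).2]; exact hvw
  · rw [(softClamp_of_one_le hw'.le).2]
    exact (softClampDeriv_mem_Icc v).2

/-- `0 ≤ r`. [folklore] -/
theorem softClamp_nonneg (v : ℝ) : 0 ≤ softClamp v := by
  rcases le_or_gt v 0 with h | h
  · rw [(softClamp_of_nonpos h).1]
  rcases le_or_gt v 1 with h' | h'
  · rw [(softClamp_of_mem h.le h').1]; positivity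
  · rw [(softClamp_of_one_le h'.le).1]; linarith

/-- `r(v) ≤ max(v, 0)`. [folklore] -/
theorem softClamp_le (v : ℝ) : softClamp v ≤ max v 0 := by
  rcases le_or_gt v 0 with h | h
  · rw [(softClamp_of_nonpos h).1]; exact le_max_right _ _
  rcases le_or_gt v 1 with h' | h'
  · rw [(softClamp_of_mem h.le h').1, max_eq_left h.le]; nlinarith
  · rw [(softClamp_of_one_le h'.le).1, max_eq_left h.le]; linarith

/-- **The saturating ramp** `G(u) = u₀ r(u/u₀) − r(u − U₁)`: a `C¹` non-decreasing function with
`G = 0` on `u ≤ 0`, `G = u²/(2u₀)` on `[0, u₀]` (soft start), `G = u − u₀/2` on `[u₀, U₁]`,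
saturating at the value `U₁ − u₀/2 + ½` for `u ≥ U₁ + 1` — the `C¹` reparametrisation through which
the printed weight `ε/(r*V)` of DRSR arXiv:1402.7034, (y2)–(y3) is glued to its constant
continuations. [folklore] -/
def satRamp (u₀ U₁ u : ℝ) : ℝ :=
  u₀ * softClamp (u / u₀) - softClamp (u - U₁)

/-- The derivative `G'(u) = r'(u/u₀) − r'(u − U₁)` of `satRamp`. [folklore] -/
def satRampDeriv (u₀ U₁ u : ℝ) : ℝ :=
  softClampDeriv (u / u₀) - softClampDeriv (u - U₁)

section Ramp

variable {u₀ U₁ : ℝ}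

/-- `G'` is the derivative of `G` (`u₀ ≠ 0`). [folklore] -/
theorem hasDerivAt_satRamp (hu₀ : u₀ ≠ 0) (u : ℝ) :
    HasDerivAt (satRamp u₀ U₁) (satRampDeriv u₀ U₁ u) u := by
  have h1 : HasDerivAt (fun u : ℝ ↦ u₀ * softClamp (u / u₀)) (softClampDeriv (u / u₀)) u := by
    have h := ((hasDerivAt_softClamp (u / u₀)).comp u ((hasDerivAt_id u).div_const u₀)).const_mul u₀
    have h' : HasDerivAt (fun u : ℝ ↦ u₀ * softClamp (u / u₀))
        (u₀ * (softClampDeriv (u / u₀) * (1 / u₀))) u := h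
    refine h'.congr_deriv ?_
    field_simp
  have h2 : HasDerivAt (fun u : ℝ ↦ softClamp (u - U₁)) (softClampDeriv (u - U₁)) u := by
    have h := (hasDerivAt_softClamp (u - U₁)).comp u ((hasDerivAt_id u).sub_const U₁)
    simpa [Function.comp_def] using h
  exact h1.sub h2

/-- `G = 0` and `G' = 0` on `u ≤ 0` (`u₀ > 0`, `U₁ ≥ 0`). [folklore] -/
theorem satRamp_of_nonpos (hu₀ : 0 < u₀) (hU₁ : 0 ≤ U₁) {u : ℝ} (hu : u ≤ 0) :
    satRamp u₀ U₁ u = 0 ∧ satRampDeriv u₀ U₁ u = 0 := by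
  have h1 := softClamp_of_nonpos (div_nonpos_of_nonpos_of_nonneg hu hu₀.le)
  have h2 := softClamp_of_nonpos (show u - U₁ ≤ 0 by linarith)
  unfold satRamp satRampDeriv
  rw [h1.1, h1.2, h2.1, h2.2]
  simp

/-- `G' = 1` on `[u₀, U₁]`. [folklore] -/
theorem satRampDeriv_eq_one (hu₀ : 0 < u₀) {u : ℝ} (h1 : u₀ ≤ u) (h2 : u ≤ U₁) :
    satRampDeriv u₀ U₁ u = 1 := by
  unfold satRampDeriv
  rw [(softClamp_of_one_le (by rwa [le_div_iff₀ hu₀, one_mul])).2,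
    (softClamp_of_nonpos (show u - U₁ ≤ 0 by linarith)).2, sub_zero]

/-- `0 ≤ G' ≤ 1` (`0 < u₀ ≤ U₁`). [folklore] -/
theorem satRampDeriv_mem_Icc (hu₀ : 0 < u₀) (hU : u₀ ≤ U₁) (u : ℝ) :
    satRampDeriv u₀ U₁ u ∈ Icc (0 : ℝ) 1 := by
  unfold satRampDeriv
  have ha := softClampDeriv_mem_Icc (u / u₀)
  have hb := softClampDeriv_mem_Icc (u - U₁)
  refine ⟨?_, by linarith [ha.2, hb.1]⟩
  rcases le_or_gt u U₁ with h | h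
  · rw [(softClamp_of_nonpos (show u - U₁ ≤ 0 by linarith)).2]; linarith [ha.1]
  · rw [(softClamp_of_one_le (show 1 ≤ u / u₀ by
      rw [le_div_iff₀ hu₀, one_mul]; linarith)).2]
    linarith [hb.2]

/-- `G` is saturated: `G(u) = U₁ − u₀/2 + ½` for `u ≥ U₁ + 1` (`0 < u₀ ≤ U₁`). [folklore] -/
theorem satRamp_eq_top (hu₀ : 0 < u₀) (hU : u₀ ≤ U₁) {u : ℝ} (hu : U₁ + 1 ≤ u) :
    satRamp u₀ U₁ u = U₁ - u₀ / 2 + 1 / 2 := by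
  unfold satRamp
  rw [(softClamp_of_one_le (show 1 ≤ u / u₀ by rw [le_div_iff₀ hu₀, one_mul]; linarith)).1,
    (softClamp_of_one_le (show 1 ≤ u - U₁ by linarith)).1]
  field_simp
  ring

/-- `G` is non-decreasing (`0 < u₀ ≤ U₁`). [folklore] -/
theorem monotone_satRamp (hu₀ : 0 < u₀) (hU : u₀ ≤ U₁) : Monotone (satRamp u₀ U₁) :=
  monotone_of_hasDerivAt_nonneg (fun u ↦ hasDerivAt_satRamp hu₀.ne' u)
    fun u ↦ (satRampDeriv_mem_Icc hu₀ hU u).1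

/-- `0 ≤ G ≤ U₁ − u₀/2 + ½` (`0 < u₀ ≤ U₁`). [folklore] -/
theorem satRamp_mem_Icc (hu₀ : 0 < u₀) (hU : u₀ ≤ U₁) (u : ℝ) :
    satRamp u₀ U₁ u ∈ Icc (0 : ℝ) (U₁ - u₀ / 2 + 1 / 2) := by
  have hm := monotone_satRamp hu₀ hU
  constructor
  · have h := hm (min_le_left u 0)
    rwa [(satRamp_of_nonpos hu₀ (hu₀.le.trans hU) (min_le_right u 0)).1] at h
  · have h := hm (le_max_left u (U₁ + 1))
    rwa [satRamp_eq_top hu₀ hU (le_max_right u (U₁ + 1))] at h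

/-- **The key inequality of the saturating ramp**: `G(u) − G'(u)(u + K) ≥ −(u₀/2 + K)` for
`u, K ≥ 0` (`0 < u₀ ≤ U₁`) — what makes the gain `−(yV)'` of DRSR arXiv:1402.7034, §8.7.1 survive
the `C¹` gluing. [folklore] -/
theorem satRamp_sub_mul_ge (hu₀ : 0 < u₀) (hU : u₀ ≤ U₁) {u K : ℝ} (hu : 0 ≤ u) (hK : 0 ≤ K) :
    -(u₀ / 2 + K) ≤ satRamp u₀ U₁ u - satRampDeriv u₀ U₁ u * (u + K) := by
  unfold satRamp satRampDeriv
  rcases le_or_gt u u₀ with h₁ | h₁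
  · -- soft start
    have hv : 0 ≤ u / u₀ ∧ u / u₀ ≤ 1 := ⟨div_nonneg hu hu₀.le, by rwa [div_le_one hu₀]⟩
    rw [(softClamp_of_mem hv.1 hv.2).1, (softClamp_of_mem hv.1 hv.2).2,
      (softClamp_of_nonpos (show u - U₁ ≤ 0 by linarith)).1,
      (softClamp_of_nonpos (show u - U₁ ≤ 0 by linarith)).2]
    have e1 : u₀ * ((u / u₀) ^ 2 / 2) - u / u₀ * (u + K) =
        -(u ^ 2 / (2 * u₀)) - u * K / u₀ := by
      field_simp
      ring
    rw [sub_zero, sub_zero, e1]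
    have h3 : u ^ 2 / (2 * u₀) ≤ u₀ / 2 := by
      rw [div_le_div_iff₀ (by positivity) (by norm_num)]; nlinarith
    have h4 : u * K / u₀ ≤ K := by
      rw [div_le_iff₀ hu₀]; nlinarith
    linarith
  have hv1 : 1 ≤ u / u₀ := by rw [le_div_iff₀ hu₀, one_mul]; exact h₁.le
  rw [(softClamp_of_one_le hv1).1, (softClamp_of_one_le hv1).2]
  have e1 : u₀ * (u / u₀ - 1 / 2) = u - u₀ / 2 := by field_simp
  rw [e1]
  rcases le_or_gt u U₁ with h₂ | h₂
  · rw [(softClamp_of_nonpos (show u - U₁ ≤ 0 by linarith)).1,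
      (softClamp_of_nonpos (show u - U₁ ≤ 0 by linarith)).2]
    nlinarith
  rcases le_or_gt u (U₁ + 1) with h₃ | h₃
  · have hw : 0 ≤ u - U₁ ∧ u - U₁ ≤ 1 := ⟨by linarith, by linarith⟩
    rw [(softClamp_of_mem hw.1 hw.2).1, (softClamp_of_mem hw.1 hw.2).2]
    nlinarith [mul_nonneg hw.1 hK, mul_nonneg hw.1 (show 0 ≤ u - (u - U₁) by linarith)]
  · rw [(softClamp_of_one_le (show 1 ≤ u - U₁ by linarith)).1,
      (softClamp_of_one_le (show 1 ≤ u - U₁ by linarith)).2]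
    nlinarith

end Ramp

/-! ### The function `F = 1/(tW) − 1/(TW(T))` and the weight -/

/-- `F(t) = 1/(tW(t)) − 1/(TW(T))` — the variable part `1/(r*V) − 1/(R₂*V(R₂*))` of the weight
(y2) of DRSR arXiv:1402.7034, §8.7.1. [cite: DafermosRodnianskiShlapentokhrothman2014, §8.7.1] -/
def lowFreqF (W : ℝ → ℝ) (T t : ℝ) : ℝ :=
  1 / (t * W t) - 1 / (T * W T)

/-- The derivative `F'(t) = −(W + tW')/(tW)²` of `lowFreqF`. [folklore] -/
def lowFreqFDeriv (W W₁ : ℝ → ℝ) (t : ℝ) : ℝ :=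
  -(W t + t * W₁ t) / (t * W t) ^ 2

/-- The saturation value `½ + ε(U₁ − u₀/2 + ½)` of the weight. [folklore] -/
def lowFreqTop (ε u₀ U₁ : ℝ) : ℝ :=
  1 / 2 + ε * (U₁ - u₀ / 2 + 1 / 2)

/-- **The low-frequency weight** `Y(t) = ½ψ(t − T + 1) + εG(F(max(t,T)))` (`ψ = softStep`,
`G = satRamp u₀ U₁`, `F = lowFreqF W T`): a `C¹` version of the weight (y1)–(y3) of DRSR
arXiv:1402.7034, §8.7.1 — `Y = 0` for `t ≤ T − 1`, a ramp to `½` on `[T − 1, T]`, then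
`½ + ε(F − u₀/2)` (up to the soft start) on the logarithmic zone, then constant.
[cite: DafermosRodnianskiShlapentokhrothman2014, §8.7.1] -/
def lowFreqWeight (W : ℝ → ℝ) (T ε u₀ U₁ t : ℝ) : ℝ :=
  softStep (t - T + 1) / 2 + ε * satRamp u₀ U₁ (lowFreqF W T (max t T))

/-- The derivative function of `lowFreqWeight`. [folklore] -/
def lowFreqWeightDeriv (W W₁ : ℝ → ℝ) (T ε u₀ U₁ t : ℝ) : ℝ :=
  softStepDeriv (t - T + 1) / 2 +
    ε * (satRampDeriv u₀ U₁ (lowFreqF W T (max t T)) * lowFreqFDeriv W W₁ (max t T))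

section Weight

variable {W W₁ : ℝ → ℝ} {T c ε u₀ U₁ : ℝ}

/-- `F(T) = 0`. [folklore] -/
@[simp] theorem lowFreqF_self (W : ℝ → ℝ) (T : ℝ) : lowFreqF W T T = 0 := by
  simp [lowFreqF]

/-- `F` is differentiable where `t ≠ 0`, `W(t) ≠ 0`. [folklore] -/
theorem hasDerivAt_lowFreqF {t : ℝ} (hW : HasDerivAt W (W₁ t) t) (ht : t ≠ 0) (hWt : W t ≠ 0) :
    HasDerivAt (lowFreqF W T) (lowFreqFDeriv W W₁ t) t := by
  have h1 : HasDerivAt (fun s : ℝ ↦ s * W s) (1 * W t + t * W₁ t) t := (hasDerivAt_id t).mul hW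
  have h2 : HasDerivAt (fun s : ℝ ↦ (s * W s)⁻¹) (-(1 * W t + t * W₁ t) / (t * W t) ^ 2) t :=
    h1.inv (mul_ne_zero ht hWt)
  have h3 := h2.sub_const (1 / (T * W T))
  have heq : lowFreqF W T = fun s ↦ (s * W s)⁻¹ - 1 / (T * W T) :=
    funext fun s ↦ by simp [lowFreqF, one_div]
  rw [heq]
  refine h3.congr_deriv ?_
  unfold lowFreqFDeriv
  ring

/-- Under `(1 + c)W ≤ −tW'` with `W > 0`: `W' ≤ 0`. [folklore] -/
theorem lowFreq_deriv_nonpos (hc : 0 ≤ c) {t : ℝ} (ht : 0 ≤ t) (hW : 0 < W t)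
    (hdec : (1 + c) * W t ≤ -(t * W₁ t)) : W₁ t ≤ 0 := by
  rcases le_or_gt (W₁ t) 0 with h | h
  · exact h
  · have : 0 ≤ t * W₁ t := mul_nonneg ht h.le
    nlinarith

/-- `W` is non-increasing on `[T − 1, ∞)`. [folklore] -/
theorem lowFreq_antitoneOn (hT : 1 ≤ T) (hc : 0 ≤ c)
    (hW : ∀ t, T - 1 ≤ t → HasDerivAt W (W₁ t) t) (hpos : ∀ t, T - 1 ≤ t → 0 < W t)
    (hdec : ∀ t, T - 1 ≤ t → (1 + c) * W t ≤ -(t * W₁ t)) : AntitoneOn W (Ici (T - 1)) := by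
  refine antitoneOn_of_deriv_nonpos (convex_Ici _)
    (fun t ht ↦ (hW t ht).continuousAt.continuousWithinAt)
    (fun t ht ↦ (hW t (interior_subset ht)).differentiableAt.differentiableWithinAt)
    fun t ht ↦ ?_
  have ht' : T - 1 ≤ t := interior_subset ht
  rw [(hW t ht').deriv]
  exact lowFreq_deriv_nonpos hc (by linarith) (hpos t ht') (hdec t ht')

/-- `tW(t)` is non-increasing on `[T − 1, ∞)`. [folklore] -/
theorem lowFreq_mul_antitoneOn (hc : 0 ≤ c)
    (hW : ∀ t, T - 1 ≤ t → HasDerivAt W (W₁ t) t) (hpos : ∀ t, T - 1 ≤ t → 0 < W t)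
    (hdec : ∀ t, T - 1 ≤ t → (1 + c) * W t ≤ -(t * W₁ t)) :
    AntitoneOn (fun t ↦ t * W t) (Ici (T - 1)) := by
  have hd : ∀ t, T - 1 ≤ t → HasDerivAt (fun s : ℝ ↦ s * W s) (1 * W t + t * W₁ t) t :=
    fun t ht ↦ (hasDerivAt_id t).mul (hW t ht)
  refine antitoneOn_of_deriv_nonpos (convex_Ici _)
    (fun t ht ↦ (hd t ht).continuousAt.continuousWithinAt)
    (fun t ht ↦ (hd t (interior_subset ht)).differentiableAt.differentiableWithinAt)
    fun t ht ↦ ?_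
  have ht' : T - 1 ≤ t := interior_subset ht
  rw [(hd t ht').deriv]
  have := hdec t ht'
  have := hpos t ht'
  nlinarith

/-- `F ≤ 0` on `[T − 1, T]` and `F ≥ 0` on `[T, ∞)`; more generally `F` is non-decreasing on
`[T − 1, ∞)`. [folklore] -/
theorem lowFreqF_monotoneOn (hT : 1 < T) (hc : 0 ≤ c)
    (hW : ∀ t, T - 1 ≤ t → HasDerivAt W (W₁ t) t) (hpos : ∀ t, T - 1 ≤ t → 0 < W t)
    (hdec : ∀ t, T - 1 ≤ t → (1 + c) * W t ≤ -(t * W₁ t)) :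
    MonotoneOn (lowFreqF W T) (Ici (T - 1)) := by
  intro s hs t ht hst
  have h : t * W t ≤ s * W s := lowFreq_mul_antitoneOn hc hW hpos hdec hs ht hst
  have ht0 : 0 < t * W t := mul_pos (by simp only [mem_Ici] at ht; linarith) (hpos t ht)
  unfold lowFreqF
  have := one_div_le_one_div_of_le ht0 h
  linarith

/-- **Lower bound for the growth of `F`**: `F(t) − F(s) ≥ c(t − s)/(t² W(s))` for
`T − 1 ≤ s ≤ t` (from `F' = (t|W'| − W)/(t²W²) ≥ c/(t²W)`). [folklore] -/
theorem lowFreqF_sub_ge (hT : 1 < T) (hc : 0 ≤ c)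
    (hW : ∀ t, T - 1 ≤ t → HasDerivAt W (W₁ t) t) (hpos : ∀ t, T - 1 ≤ t → 0 < W t)
    (hdec : ∀ t, T - 1 ≤ t → (1 + c) * W t ≤ -(t * W₁ t)) {s t : ℝ} (hs : T - 1 ≤ s)
    (hst : s ≤ t) : c * (t - s) / (t ^ 2 * W s) ≤ lowFreqF W T t - lowFreqF W T s := by
  have hs0 : 0 < s := by linarith
  have ht0 : 0 < t := by linarith
  have hWs := hpos s hs
  have hanti := lowFreq_antitoneOn hT.le hc hW hpos hdec
  have hd : ∀ τ, T - 1 ≤ τ → HasDerivAt (lowFreqF W T) (lowFreqFDeriv W W₁ τ) τ := fun τ hτ ↦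
    hasDerivAt_lowFreqF (hW τ hτ) (by linarith) (hpos τ hτ).ne'
  -- derivative lower bound on [s, t]
  have hC : ∀ τ ∈ interior (Icc s t), c / (t ^ 2 * W s) ≤ deriv (lowFreqF W T) τ := by
    intro τ hτ
    rw [interior_Icc] at hτ
    have hτ' : T - 1 ≤ τ := by linarith [hτ.1]
    rw [(hd τ hτ').deriv]
    have hWτ := hpos τ hτ'
    have hτ0 : 0 < τ := by linarith [hτ.1]
    have hdecτ := hdec τ hτ'
    have hWle : W τ ≤ W s := hanti hs (show τ ∈ Ici (T - 1) from hτ') hτ.1.le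
    unfold lowFreqFDeriv
    rw [div_le_div_iff₀ (by positivity) (by positivity)]
    -- c (τ W τ)² ≤ -(W τ + τ W₁ τ) * (t² W s)
    have h1 : c * W τ ≤ -(W τ + τ * W₁ τ) := by linarith
    have h2 : (τ * W τ) ^ 2 ≤ t ^ 2 * W s * W τ := by
      have : τ ^ 2 ≤ t ^ 2 := by nlinarith [hτ.2]
      calc (τ * W τ) ^ 2 = τ ^ 2 * W τ * W τ := by ring
        _ ≤ t ^ 2 * W s * W τ := by gcongr
    calc c * (τ * W τ) ^ 2 ≤ c * (t ^ 2 * W s * W τ) := by gcongr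
      _ = (c * W τ) * (t ^ 2 * W s) := by ring
      _ ≤ -(W τ + τ * W₁ τ) * (t ^ 2 * W s) := by gcongr
  have h := (convex_Icc s t).mul_sub_le_image_sub_of_le_deriv
    (fun τ hτ ↦ (hd τ (by linarith [hτ.1])).continuousAt.continuousWithinAt)
    (fun τ hτ ↦ (hd τ (by rw [interior_Icc] at hτ; linarith [hτ.1])).differentiableAt.differentiableWithinAt)
    hC s (left_mem_Icc.2 hst) t (right_mem_Icc.2 hst) hst
  calc c * (t - s) / (t ^ 2 * W s) = c / (t ^ 2 * W s) * (t - s) := by ring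
    _ ≤ _ := h

/-- `F' ≥ 0` on `[T − 1, ∞)`. [folklore] -/
theorem lowFreqFDeriv_nonneg (hc : 0 ≤ c) {t : ℝ} (hW : 0 < W t)
    (hdec : (1 + c) * W t ≤ -(t * W₁ t)) : 0 ≤ lowFreqFDeriv W W₁ t := by
  unfold lowFreqFDeriv
  apply div_nonneg _ (sq_nonneg _)
  nlinarith

/-- **The identity behind the gain**: `F'(t)·W = |W'|(F + K) − 1/t²` with `K = 1/(TW(T))`,
i.e. `−(yV)' = ε/(r*)² − cV'` for `y = ε/(r*V) + c` (DRSR arXiv:1402.7034, proof of Prop. 8.7.1,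
(someInequality)). [cite: DafermosRodnianskiShlapentokhrothman2014, §8.7.1] -/
theorem lowFreqFDeriv_mul {t : ℝ} (ht : t ≠ 0) (hW : W t ≠ 0) :
    lowFreqFDeriv W W₁ t * W t =
      -W₁ t * (lowFreqF W T t + 1 / (T * W T)) - 1 / t ^ 2 := by
  unfold lowFreqFDeriv lowFreqF
  field_simp
  ring

/-- `Y = ½ψ(t − T + 1)` and `Y' = ½ψ'(t − T + 1)` for `t ≤ T` (`U₁ ≥ 0`, `u₀ > 0`). [folklore] -/
theorem lowFreqWeight_of_le_T (hu₀ : 0 < u₀) (hU₁ : 0 ≤ U₁) {t : ℝ} (ht : t ≤ T) :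
    lowFreqWeight W T ε u₀ U₁ t = softStep (t - T + 1) / 2 ∧
      lowFreqWeightDeriv W W₁ T ε u₀ U₁ t = softStepDeriv (t - T + 1) / 2 := by
  unfold lowFreqWeight lowFreqWeightDeriv
  rw [max_eq_right ht, lowFreqF_self]
  have h := satRamp_of_nonpos hu₀ hU₁ (le_refl (0 : ℝ))
  rw [h.1, h.2]
  simp

/-- `Y = 0`, `Y' = 0` for `t ≤ T − 1`. [cite: DafermosRodnianskiShlapentokhrothman2014, §8.7.1] -/
theorem lowFreqWeight_of_le (hu₀ : 0 < u₀) (hU₁ : 0 ≤ U₁) {t : ℝ} (ht : t ≤ T - 1) :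
    lowFreqWeight W T ε u₀ U₁ t = 0 ∧ lowFreqWeightDeriv W W₁ T ε u₀ U₁ t = 0 := by
  have h := lowFreqWeight_of_le_T (W := W) (W₁ := W₁) (ε := ε) hu₀ hU₁ (show t ≤ T by linarith)
  rw [h.1, h.2, softStep_of_nonpos (by linarith), softStepDeriv_of_nonpos (by linarith)]
  simp

/-- `Y = ½ + εG(F(t))` and `Y' = εG'(F(t))F'(t)` for `t ≥ T`. [folklore] -/
theorem lowFreqWeight_of_ge {t : ℝ} (ht : T ≤ t) :
    lowFreqWeight W T ε u₀ U₁ t = 1 / 2 + ε * satRamp u₀ U₁ (lowFreqF W T t) ∧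
      lowFreqWeightDeriv W W₁ T ε u₀ U₁ t =
        ε * (satRampDeriv u₀ U₁ (lowFreqF W T t) * lowFreqFDeriv W W₁ t) := by
  unfold lowFreqWeight lowFreqWeightDeriv
  rw [max_eq_left ht, softStep_of_one_le (by linarith), softStepDeriv_of_one_le (by linarith)]
  simp

/-- **`Y` is differentiable with derivative `Y'`** (everywhere on `ℝ`), provided `T > 1`,
`W > 0` with `(1 + c)W ≤ −tW'` on `[T − 1, ∞)`, `u₀ > 0`, `U₁ ≥ 0`. [folklore] -/
theorem hasDerivAt_lowFreqWeight (hT : 1 < T) (hc : 0 ≤ c)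
    (hW : ∀ t, T - 1 ≤ t → HasDerivAt W (W₁ t) t) (hpos : ∀ t, T - 1 ≤ t → 0 < W t)
    (hdec : ∀ t, T - 1 ≤ t → (1 + c) * W t ≤ -(t * W₁ t)) (hu₀ : 0 < u₀) (hU₁ : 0 ≤ U₁)
    (t : ℝ) :
    HasDerivAt (lowFreqWeight W T ε u₀ U₁) (lowFreqWeightDeriv W W₁ T ε u₀ U₁ t) t := by
  have hramp : ∀ s, HasDerivAt (fun s : ℝ ↦ softStep (s - T + 1) / 2)
      (softStepDeriv (s - T + 1) / 2) s := fun s ↦ by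
    have h := ((hasDerivAt_softStep (s - T + 1)).comp s
      (((hasDerivAt_id s).sub_const T).add_const 1)).div_const 2
    simpa [Function.comp_def] using h
  rcases lt_or_ge t T with h | h
  · -- left of `T`: the `G`-part vanishes identically
    have hev : lowFreqWeight W T ε u₀ U₁ =ᶠ[𝓝 t] fun s ↦ softStep (s - T + 1) / 2 := by
      filter_upwards [Iio_mem_nhds h] with s hs
        using (lowFreqWeight_of_le_T (W := W) (W₁ := W₁) (ε := ε) hu₀ hU₁ hs.le).1
    rw [(lowFreqWeight_of_le_T (W := W) (W₁ := W₁) (ε := ε) hu₀ hU₁ h.le).2]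
    exact (hramp t).congr_of_eventuallyEq hev
  · -- right of `T` (including `T`): agree with the smooth formula on `(T − 1, ∞)`
    have hmono := lowFreqF_monotoneOn hT hc hW hpos hdec
    have hev : lowFreqWeight W T ε u₀ U₁ =ᶠ[𝓝 t]
        fun s ↦ softStep (s - T + 1) / 2 + ε * satRamp u₀ U₁ (lowFreqF W T s) := by
      filter_upwards [Ioi_mem_nhds (show T - 1 < t by linarith)] with s hs
      rcases le_or_gt T s with hs' | hs'
      · unfold lowFreqWeight; rw [max_eq_left hs']
      · rw [(lowFreqWeight_of_le_T (W := W) (W₁ := W₁) (ε := ε) hu₀ hU₁ hs'.le).1]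
        have hF : lowFreqF W T s ≤ 0 := by
          have := hmono (mem_Ici.2 (le_of_lt hs)) (mem_Ici.2 (by linarith)) hs'.le
          rwa [lowFreqF_self] at this
        rw [(satRamp_of_nonpos hu₀ hU₁ hF).1]
        simp
    have ht0 : 0 < t := by linarith
    have hF := hasDerivAt_lowFreqF (T := T) (hW t (by linarith)) ht0.ne' (hpos t (by linarith)).ne'
    have hG := (hasDerivAt_satRamp (U₁ := U₁) hu₀.ne' (lowFreqF W T t)).comp t hF
    have hd := (hramp t).add (hG.const_mul ε)
    refine (hd.congr_of_eventuallyEq hev).congr_deriv ?_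
    rw [(lowFreqWeight_of_ge (W := W) (W₁ := W₁) (ε := ε) (u₀ := u₀) (U₁ := U₁) h).2,
      softStepDeriv_of_one_le (by linarith)]
    simp

/-- `Y' ≥ 0` (on all of `ℝ`). [cite: DafermosRodnianskiShlapentokhrothman2014, §8.7.1] -/
theorem lowFreqWeightDeriv_nonneg (hc : 0 ≤ c) (hε : 0 ≤ ε)
    (hpos : ∀ t, T - 1 ≤ t → 0 < W t)
    (hdec : ∀ t, T - 1 ≤ t → (1 + c) * W t ≤ -(t * W₁ t)) (hu₀ : 0 < u₀) (hU : u₀ ≤ U₁)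
    (t : ℝ) : 0 ≤ lowFreqWeightDeriv W W₁ T ε u₀ U₁ t := by
  have hs := (softStepDeriv_mem_Icc (t - T + 1)).1
  rcases le_or_gt t T with h | h
  · rw [(lowFreqWeight_of_le_T (W := W) (W₁ := W₁) (ε := ε) hu₀ (hu₀.le.trans hU) h).2]
    linarith
  · rw [(lowFreqWeight_of_ge (W := W) (W₁ := W₁) (ε := ε) (u₀ := u₀) (U₁ := U₁) h.le).2]
    exact mul_nonneg hε (mul_nonneg (satRampDeriv_mem_Icc hu₀ hU _).1
      (lowFreqFDeriv_nonneg hc (hpos t (by linarith)) (hdec t (by linarith))))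

/-- `0 ≤ Y ≤ lowFreqTop`. [folklore] -/
theorem lowFreqWeight_mem_Icc (hε : 0 ≤ ε) (hu₀ : 0 < u₀) (hU : u₀ ≤ U₁) (t : ℝ) :
    lowFreqWeight W T ε u₀ U₁ t ∈ Icc (0 : ℝ) (lowFreqTop ε u₀ U₁) := by
  unfold lowFreqWeight lowFreqTop
  have h1 := softStep_mem_Icc (t - T + 1)
  have h2 := satRamp_mem_Icc hu₀ hU (lowFreqF W T (max t T))
  constructor
  · nlinarith [h1.1, h2.1]
  · nlinarith [h1.2, h2.2]

/-- `Y` is saturated, `Y = lowFreqTop`, at every `t ≥ T` with `F(t) ≥ U₁ + 1`. [folklore] -/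
theorem lowFreqWeight_eq_top (hu₀ : 0 < u₀) (hU : u₀ ≤ U₁) {t : ℝ} (ht : T ≤ t)
    (hF : U₁ + 1 ≤ lowFreqF W T t) : lowFreqWeight W T ε u₀ U₁ t = lowFreqTop ε u₀ U₁ := by
  rw [(lowFreqWeight_of_ge (W := W) (W₁ := W) (ε := ε) (u₀ := u₀) (U₁ := U₁) ht).1,
    satRamp_eq_top hu₀ hU hF]
  rfl

/-! ### The gain and the coefficient inequality -/

/-- **The gain of the weight.** For `t ≥ T`:
`−(Y'W + YW') ≥ ¼|W'| + εG'(F(t))/t²`, provided `5ε ≤ TW(T)` and `u₀ = c/(4TW(T))` — the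
inequality `h(V − ω²) − (yV)' − ½h'' ≥ (ε − Bp)(r*)⁻² − (½ − ε/(R₂*V₂))V'` of DRSR
arXiv:1402.7034, (someInequality), in the glued version. [cite: DafermosRodnianskiShlapentokhrothman2014, §8.7.1] -/
theorem lowFreq_gain_ge (hT : 1 < T) (hc : 0 < c) (hc1 : c ≤ 1) (hε : 0 < ε)
    (hW : ∀ t, T - 1 ≤ t → HasDerivAt W (W₁ t) t) (hpos : ∀ t, T - 1 ≤ t → 0 < W t)
    (hdec : ∀ t, T - 1 ≤ t → (1 + c) * W t ≤ -(t * W₁ t)) (hεK : 5 * ε ≤ T * W T)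
    (hu₀ : u₀ = c / (4 * T * W T)) (hU : u₀ ≤ U₁) {t : ℝ} (ht : T ≤ t) :
    1 / 4 * (-W₁ t) + ε * satRampDeriv u₀ U₁ (lowFreqF W T t) / t ^ 2 ≤
      -(lowFreqWeightDeriv W W₁ T ε u₀ U₁ t * W t + lowFreqWeight W T ε u₀ U₁ t * W₁ t) := by
  have hT0 : 0 < T := by linarith
  have ht0 : 0 < t := by linarith
  have hWT := hpos T (by linarith)
  have hWt := hpos t (by linarith)
  have hu₀pos : 0 < u₀ := by rw [hu₀]; positivity
  have hid := lowFreqFDeriv_mul (W := W) (W₁ := W₁) (T := T) ht0.ne' hWt.ne'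
  set K : ℝ := 1 / (T * W T) with hK
  have hK0 : 0 < K := by positivity
  have hεK' : ε * K ≤ 1 / 5 := by
    rw [hK, ← mul_div_assoc, mul_one, div_le_div_iff₀ (by positivity) (by norm_num)]
    linarith
  have hu₀K : u₀ = c / 4 * K := by rw [hu₀, hK]; field_simp
  have hW₁ : W₁ t ≤ 0 := lowFreq_deriv_nonpos hc.le ht0.le hWt (hdec t (by linarith))
  set F := lowFreqF W T t with hFdef
  have hF0 : 0 ≤ F := by
    have := lowFreqF_monotoneOn hT hc.le hW hpos hdec (show T ∈ Ici (T - 1) by simp)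
      (show t ∈ Ici (T - 1) by simp only [mem_Ici]; linarith) ht
    rwa [lowFreqF_self] at this
  have hYW := lowFreqWeight_of_ge (W := W) (W₁ := W₁) (ε := ε) (u₀ := u₀) (U₁ := U₁) ht
  rw [hYW.1, hYW.2]
  have hbr := satRamp_sub_mul_ge hu₀pos hU hF0 hK0.le
  set G := satRamp u₀ U₁ F
  set G' := satRampDeriv u₀ U₁ F
  have hG' := satRampDeriv_mem_Icc hu₀pos hU F
  -- the algebra: -(ε G' F' W + (1/2 + ε G) W₁) = 1/2 |W₁| + ε |W₁| (G − G'(F+K)) + ε G'/t²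
  have key : -(ε * (G' * lowFreqFDeriv W W₁ t) * W t + (1 / 2 + ε * G) * W₁ t) =
      1 / 2 * (-W₁ t) + ε * (-W₁ t) * (G - G' * (F + K)) + ε * G' / t ^ 2 := by
    have : ε * (G' * lowFreqFDeriv W W₁ t) * W t = ε * G' * (lowFreqFDeriv W W₁ t * W t) := by ring
    rw [this, hid]
    field_simp
    ring
  rw [key]
  have h1 : -(u₀ / 2 + K) ≤ G - G' * (F + K) := hbr
  have h2 : ε * (u₀ / 2 + K) ≤ 1 / 4 := by
    rw [hu₀K]
    nlinarith
  nlinarith [mul_le_mul_of_nonneg_left h1 (mul_nonneg hε.le (neg_nonneg.2 hW₁))]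

/-- `u₀ ≤ F(2T)` (the soft start is over before the logarithmic zone begins): from
`F(2T) − F(T) ≥ cT/((2T)²W(T)) = c/(4TW(T)) = u₀`. [folklore] -/
theorem lowFreq_u₀_le (hT : 1 < T) (hc : 0 ≤ c)
    (hW : ∀ t, T - 1 ≤ t → HasDerivAt W (W₁ t) t) (hpos : ∀ t, T - 1 ≤ t → 0 < W t)
    (hdec : ∀ t, T - 1 ≤ t → (1 + c) * W t ≤ -(t * W₁ t)) (hu₀ : u₀ = c / (4 * T * W T)) :
    u₀ ≤ lowFreqF W T (2 * T) := by
  have hT0 : 0 < T := by linarith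
  have h := lowFreqF_sub_ge hT hc hW hpos hdec (s := T) (t := 2 * T) (by linarith) (by linarith)
  rw [lowFreqF_self, sub_zero] at h
  have e : c * (2 * T - T) / ((2 * T) ^ 2 * W T) = c / (4 * T * W T) := by
    have := (hpos T (by linarith)).ne'
    field_simp
    ring
  rw [hu₀, ← e]
  exact h

/-- **The coefficient inequality of the low-frequency weight and cut-off** (DRSR
arXiv:1402.7034, proof of Prop. 8.7.1: "the integrand of the left hand side of (axisym2) is
non-negative in the region `r* ∈ [R₊*, ∞)`", made quantitative and glued). Let `T > 1`,
`0 < c ≤ 1`, `W > 0` differentiable with `(1 + c)W ≤ −tW'` on `[T − 1, ∞)`, `0 < ε` with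
`5ε ≤ TW(T)`, `u₀ = c/(4TW(T))`, `0 < p ≤ 1` with `p(D₁ + D₂) ≤ 2ε` (`Dᵢ` bounds for `|φ'|`,
`|φ''|`), `Tₕ = 2T`, `Tₑ = 2Te^{1/p}`, `F(Tₑ) ≤ U₁`, and `ϖ² ≤ W(Tₑ)`. Then for every
`t ≥ T − 1`:
`h(t)(W − ϖ²) − ½h''(t) + Y'(t)(ϖ² − W) − Y(t)W'(t) ≥ 0`.
[cite: DafermosRodnianskiShlapentokhrothman2014, Prop. 8.7.1 (proof)] -/
theorem lowFreq_coeff_nonneg {p D₁ D₂ ϖ : ℝ} (hT : 1 < T) (hc : 0 < c) (hc1 : c ≤ 1) (hε : 0 < ε)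
    (hp : 0 < p) (hp1 : p ≤ 1) (hD₁ : ∀ s, |sharpBump₁ s| ≤ D₁) (hD₂ : ∀ s, |sharpBump₂ s| ≤ D₂)
    (hpε : p * (D₁ + D₂) ≤ 2 * ε)
    (hW : ∀ t, T - 1 ≤ t → HasDerivAt W (W₁ t) t) (hpos : ∀ t, T - 1 ≤ t → 0 < W t)
    (hdec : ∀ t, T - 1 ≤ t → (1 + c) * W t ≤ -(t * W₁ t)) (hεK : 5 * ε ≤ T * W T)
    (hu₀ : u₀ = c / (4 * T * W T)) (hU₁ : lowFreqF W T (2 * T * Real.exp (1 / p)) ≤ U₁)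
    (hϖ : ϖ ^ 2 ≤ W (2 * T * Real.exp (1 / p))) {t : ℝ} (ht : T - 1 ≤ t) :
    0 ≤ lowFreqCutoff p (2 * T) t * (W t - ϖ ^ 2) - 1 / 2 * lowFreqCutoff₂ p (2 * T) t +
      lowFreqWeightDeriv W W₁ T ε u₀ U₁ t * (ϖ ^ 2 - W t) -
      lowFreqWeight W T ε u₀ U₁ t * W₁ t := by
  have hT0 : 0 < T := by linarith
  have hTh : 0 < 2 * T := by linarith
  have ht0 : 0 < t := by linarith
  have hWt := hpos t ht
  have hW₁ : W₁ t ≤ 0 := lowFreq_deriv_nonpos hc.le ht0.le hWt (hdec t ht)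
  have hanti := lowFreq_antitoneOn hT.le hc.le hW hpos hdec
  have hmono := lowFreqF_monotoneOn hT hc.le hW hpos hdec
  have hu₀pos : 0 < u₀ := by rw [hu₀]; have := hpos T (by linarith); positivity
  have hexp : 1 < Real.exp (1 / p) := Real.one_lt_exp_iff.2 (one_div_pos.2 hp)
  set Te := 2 * T * Real.exp (1 / p) with hTe
  have hTe2 : 2 * T ≤ Te := by rw [hTe]; nlinarith
  have hu₀F : u₀ ≤ lowFreqF W T (2 * T) := lowFreq_u₀_le hT hc.le hW hpos hdec hu₀
  have hU : u₀ ≤ U₁ := by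
    refine hu₀F.trans (le_trans (hmono ?_ ?_ hTe2) hU₁) <;> simp only [mem_Ici] <;> linarith
  -- `W ≥ ϖ²` up to `Te`
  have hWϖ : t ≤ Te → ϖ ^ 2 ≤ W t := fun hle ↦
    hϖ.trans (hanti (show t ∈ Ici (T - 1) from ht) (show Te ∈ Ici (T - 1) by
      simp only [mem_Ici]; linarith) hle)
  rcases le_or_gt t T with h₁ | h₁
  · -- ramp zone: h = 1, h'' = 0, Y = ψ/2, Y' = ψ'/2 ≤ 1
    have hY := lowFreqWeight_of_le_T (W := W) (W₁ := W₁) (ε := ε) hu₀pos (hu₀pos.le.trans hU) h₁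
    rw [hY.1, hY.2, lowFreqCutoff_eq_one hTh (by linarith), lowFreqCutoff₂_eq_zero_of_le hTh (by linarith)]
    have hs := softStep_mem_Icc (t - T + 1)
    have hs' := softStepDeriv_mem_Icc (t - T + 1)
    have hϖ' := hWϖ (by linarith)
    nlinarith [mul_nonneg (show 0 ≤ 1 - softStepDeriv (t - T + 1) / 2 by linarith [hs'.2])
      (sub_nonneg.2 hϖ'), mul_nonneg hs.1 (neg_nonneg.2 hW₁)]
  -- t ≥ T: use the gain
  have hgain := lowFreq_gain_ge hT hc hc1 hε hW hpos hdec hεK hu₀ hU h₁.le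
  have hY'0 := lowFreqWeightDeriv_nonneg (W := W) (W₁ := W₁) (ε := ε) hc.le hε.le hpos hdec
    hu₀pos hU t
  set Y := lowFreqWeight W T ε u₀ U₁ t
  set Y' := lowFreqWeightDeriv W W₁ T ε u₀ U₁ t
  have hG' := satRampDeriv_mem_Icc hu₀pos hU (lowFreqF W T t)
  -- rewrite the goal as h(W − ϖ²) − ½h'' + Y'ϖ² + gain
  have hsplit : lowFreqCutoff p (2 * T) t * (W t - ϖ ^ 2) - 1 / 2 * lowFreqCutoff₂ p (2 * T) t +
      Y' * (ϖ ^ 2 - W t) - Y * W₁ t =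
      lowFreqCutoff p (2 * T) t * (W t - ϖ ^ 2) - 1 / 2 * lowFreqCutoff₂ p (2 * T) t +
      Y' * ϖ ^ 2 + (-(Y' * W t + Y * W₁ t)) := by ring
  rw [hsplit]
  have hh := lowFreqCutoff_mem_Icc p (2 * T) t
  rcases le_or_gt t (2 * T) with h₂ | h₂
  · -- soft-start zone: h = 1, h'' = 0
    rw [lowFreqCutoff_eq_one hTh h₂, lowFreqCutoff₂_eq_zero_of_le hTh h₂]
    have hϖ' := hWϖ (by linarith)
    have : 0 ≤ ε * satRampDeriv u₀ U₁ (lowFreqF W T t) / t ^ 2 := by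
      have := hG'.1; positivity
    nlinarith [mul_nonneg hY'0 (sq_nonneg ϖ)]
  rcases le_or_gt t Te with h₃ | h₃
  · -- logarithmic zone: G'(F) = 1, ½|h''| ≤ ε/t²
    have hϖ' := hWϖ h₃
    have hFt : u₀ ≤ lowFreqF W T t ∧ lowFreqF W T t ≤ U₁ := by
      constructor
      · exact hu₀F.trans (hmono (show (2 * T) ∈ Ici (T - 1) by simp only [mem_Ici]; linarith)
          (show t ∈ Ici (T - 1) from ht) h₂.le)
      · exact le_trans (hmono (show t ∈ Ici (T - 1) from ht)
          (show Te ∈ Ici (T - 1) by simp only [mem_Ici]; linarith) h₃) hU₁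
    rw [satRampDeriv_eq_one hu₀pos hFt.1 hFt.2] at hgain
    have hh'' := abs_lowFreqCutoff₂_le hD₁ hD₂ hp hp1 hTh h₂.le
    have hh''2 : |lowFreqCutoff₂ p (2 * T) t| ≤ 2 * ε / t ^ 2 := by
      refine hh''.trans ?_
      rw [div_le_div_iff_of_pos_right (pow_pos ht0 2)]
      exact hpε
    have habs := le_abs_self (lowFreqCutoff₂ p (2 * T) t)
    have : ε * 1 / t ^ 2 = 1 / 2 * (2 * ε / t ^ 2) := by ring
    nlinarith [mul_nonneg hh.1 (sub_nonneg.2 hϖ'), mul_nonneg hY'0 (sq_nonneg ϖ),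
      neg_nonneg.2 hW₁]
  · -- tail: h = 0, h'' = 0
    rw [lowFreqCutoff_eq_zero hTh hp h₃.le, lowFreqCutoff₂_eq_zero_of_ge hTh hp h₃.le]
    have : 0 ≤ ε * satRampDeriv u₀ U₁ (lowFreqF W T t) / t ^ 2 := by
      have := hG'.1; positivity
    nlinarith [mul_nonneg hY'0 (sq_nonneg ϖ), neg_nonneg.2 hW₁]

end Weight

end Kerr

end Literature.Geometry.Lorentzian
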